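import Summits.CriticalPhenomena.CardyFormulaZ2.Theorems.CardyComplexConeEdgePrecompactUFRSMixedSectors

/-!
# Sectors of corner-disjoint strands of several completions: the variant exporting the chains
(line `qkz-strip-boundary-arm` of crux `CardyComplexCone.EdgePrecompact`, stmt-CriticalPhenomena-11387;
input of the corrected three-strands dichotomy behind the flat three-strand decay HT for MIXED
tags — worker W-HT5 of lead c5, wave 5)

`strands_sectorsZ_mixed_HT4` (`…UFRSMixedSectors.lean`) returns, for `k` corner-disjoint orbit
stretches of several completed configurations crossing an annulus, the left / right sectors and
one left walk and one right walk per strand, but hides the sub-chain `[i', j']` of each stretch on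
which the walks are built. The corrected dichotomy (GOOD / BAD(p) / CRAWL, see
`…UFRSCrawlTrichotomy.lean`) reasons about the FAKE followed edges (completed-open, `ω`-closed)
along that very chain: it needs the chain indices, the membership of every chain vertex in the
left sector and of every chain face centre in the right sector (for the probe below a fake
touchdown), the distance window of the chain, which end of the chain is near the centre, and the
absorption property of the sectors (a preconnected subset of the annulus missing all pieces and
meeting a sector lies in it). This file re-runs the proof of `strands_sectorsZ_mixed_HT4` and
exports exactly these data (`strands_sectorsZ_chains_HT5`, registered anchor
`ufrs_strandsSectorsZ_chains`); walks are then rebuilt by the caller with `exists_leftWalk` /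
`exists_rightWalk` on any sub-chain.

References: M. Aizenman, A. Burchard, Duke Math. J. 99 (1999), App. A, Lemma A.5;
S. Smirnov, C. R. Acad. Sci. Paris 333 (2001), §2.
(buildfix 2026-08-20: comment-only re-land to re-enqueue the module build after its blocking imports were repaired; no declaration changed.)
-/

namespace Summit.CriticalPhenomena.CardyFormulaZ2.Cruxes.EdgePrecompact.QkzStripBoundaryArm

open MeasureTheory Filter Set Metric Complex
open scoped Topology BigOperators Pointwise
open Literature.Probability.LatticeModels Literature.Probability.Percolation
open Literature.Probability.RandomPlanarGeometry (DobrushinDomain)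
open Summit.CriticalPhenomena.CardyFormulaZ2.Theses.CardyComplexCone
open Literature.Topology.PlaneTopology

noncomputable section

/-- **Sectors of corner-disjoint strands of several configurations, with their chains** (mesh `1`;
hypotheses verbatim those of `strands_sectorsZ_mixed_HT4`). Conclusion: left sectors `cL`, right
sectors `cR` (pairwise equal or disjoint, no three strands with the same sector, at most one of
each kind meeting `Z`, inside the open annulus `(r + 1/2, R - 1/2)`, preconnected, missing every
piece of every stretch, and ABSORBING: a preconnected subset of the annulus missing all pieces and
meeting the sector lies in it), and for every strand a sub-chain `[i' s, j' s] ⊆ [i s, j s]` whose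
vertices lie in `cL s`, whose face centres lie in `cR s`, all at distance in `(r + 1, R - 1)`, one
end of the chain within `r + 3` and the other beyond `R - 3`. -/
theorem strands_sectorsZ_chains_HT5 {k : ℕ} (β : Fin k → BondConfig (Site 2)) (z : ℂ) (c : Fin k → Site 2 × Fin 4)
    (i j : Fin k → ℕ) {r R : ℝ} (hr : 0 ≤ r) (hrR : r + 16 ≤ R) (hij : ∀ a, i a ≤ j a)
    (hdir : ∀ a, (dist (Site.toComplex (cornerOrbit (β a) (c a) (i a)).1) z ≤ r ∧
        R ≤ dist (Site.toComplex (cornerOrbit (β a) (c a) (j a)).1) z) ∨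
      (R ≤ dist (Site.toComplex (cornerOrbit (β a) (c a) (i a)).1) z ∧
        dist (Site.toComplex (cornerOrbit (β a) (c a) (j a)).1) z ≤ r))
    (hdis : ∀ a b, a ≠ b → ∀ s t, i a ≤ s → s ≤ j a → i b ≤ t → t ≤ j b →
      cornerOrbit (β a) (c a) s ≠ cornerOrbit (β b) (c b) t)
    (Z : Set ℂ) (hZU : ∀ w ∈ Z, r + 1 / 2 < dist w z ∧ dist w z < R - 1 / 2) (hZc : IsPreconnected Z)
    (hZK : ∀ a t, i a ≤ t → t ≤ j a →
      (∀ w ∈ segment ℝ (sPt (cornerOrbit (β a) (c a) t)) (tPt (cornerOrbit (β a) (c a) t)), w ∉ Z) ∧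
      (t < j a → ∀ w ∈ segment ℝ (tPt (cornerOrbit (β a) (c a) t)) (sPt (cornerOrbit (β a) (c a) (t + 1))), w ∉ Z)) :
    ∃ (cL cR : Fin k → Set ℂ) (i' j' : Fin k → ℕ),
      (∀ s₁ s₂ (P : ℂ), P ∈ cL s₁ → P ∈ cL s₂ → cL s₁ = cL s₂) ∧
      (∀ s₁ s₂ (P : ℂ), P ∈ cR s₁ → P ∈ cR s₂ → cR s₁ = cR s₂) ∧
      (∀ a₁ a₂ a₃ : Fin k, a₁ ≠ a₂ → a₂ ≠ a₃ → a₃ ≠ a₁ → cL a₁ = cL a₂ → cL a₂ = cL a₃ → False) ∧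
      (∀ a₁ a₂ a₃ : Fin k, a₁ ≠ a₂ → a₂ ≠ a₃ → a₃ ≠ a₁ → cR a₁ = cR a₂ → cR a₂ = cR a₃ → False) ∧
      (∀ s₁ s₂, (cL s₁ ∩ Z).Nonempty → (cL s₂ ∩ Z).Nonempty → cL s₁ = cL s₂) ∧
      (∀ s₁ s₂, (cR s₁ ∩ Z).Nonempty → (cR s₂ ∩ Z).Nonempty → cR s₁ = cR s₂) ∧
      (∀ s, ∀ w ∈ cL s ∪ cR s, r + 1 / 2 < dist w z ∧ dist w z < R - 1 / 2) ∧
      (∀ s, cL s ⊆ {w | r + 1 / 2 < dist w z ∧ dist w z < R - 1 / 2} ∧ cR s ⊆ {w | r + 1 / 2 < dist w z ∧ dist w z < R - 1 / 2} ∧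
        IsPreconnected (cL s) ∧ IsPreconnected (cR s) ∧
        (∀ w ∈ cL s, ∀ a jj, jj ≤ 2 * (j a - i a) →
          w ∉ segment ℝ (pieceVert (β a) (cornerOrbit (β a) (c a) (i a)) jj) (pieceVert (β a) (cornerOrbit (β a) (c a) (i a)) (jj + 1))) ∧
        (∀ w ∈ cR s, ∀ a jj, jj ≤ 2 * (j a - i a) →
          w ∉ segment ℝ (pieceVert (β a) (cornerOrbit (β a) (c a) (i a)) jj) (pieceVert (β a) (cornerOrbit (β a) (c a) (i a)) (jj + 1))) ∧
        (∀ S : Set ℂ, IsPreconnected S → S ⊆ {w | r + 1 / 2 < dist w z ∧ dist w z < R - 1 / 2} →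
          (∀ w ∈ S, ∀ a jj, jj ≤ 2 * (j a - i a) →
            w ∉ segment ℝ (pieceVert (β a) (cornerOrbit (β a) (c a) (i a)) jj) (pieceVert (β a) (cornerOrbit (β a) (c a) (i a)) (jj + 1))) →
          ((S ∩ cL s).Nonempty → S ⊆ cL s) ∧ ((S ∩ cR s).Nonempty → S ⊆ cR s))) ∧
      (∀ s, i s ≤ i' s ∧ i' s ≤ j' s ∧ j' s ≤ j s ∧
        (∀ t, i' s ≤ t → t ≤ j' s →
          Site.toComplex (cornerOrbit (β s) (c s) t).1 ∈ cL s ∧ faceCenter (cFace (cornerOrbit (β s) (c s) t)) ∈ cR s ∧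
          r + 1 < dist (Site.toComplex (cornerOrbit (β s) (c s) t).1) z ∧ dist (Site.toComplex (cornerOrbit (β s) (c s) t).1) z < R - 1 ∧
          r + 1 < dist (faceCenter (cFace (cornerOrbit (β s) (c s) t))) z ∧ dist (faceCenter (cFace (cornerOrbit (β s) (c s) t))) z < R - 1) ∧
        ((dist (Site.toComplex (cornerOrbit (β s) (c s) (i' s)).1) z < r + 3 ∧ dist (faceCenter (cFace (cornerOrbit (β s) (c s) (i' s)))) z < r + 3 ∧
            R - 3 < dist (Site.toComplex (cornerOrbit (β s) (c s) (j' s)).1) z ∧ R - 3 < dist (faceCenter (cFace (cornerOrbit (β s) (c s) (j' s)))) z) ∨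
          (R - 3 < dist (Site.toComplex (cornerOrbit (β s) (c s) (i' s)).1) z ∧ R - 3 < dist (faceCenter (cFace (cornerOrbit (β s) (c s) (i' s)))) z ∧
            dist (Site.toComplex (cornerOrbit (β s) (c s) (j' s)).1) z < r + 3 ∧ dist (faceCenter (cFace (cornerOrbit (β s) (c s) (j' s)))) z < r + 3))) := by
  classical
  set q : Fin k → Site 2 × Fin 4 := fun a => cornerOrbit (β a) (c a) (i a) with hq
  set n : Fin k → ℕ := fun a => j a - i a with hn
  have horb : ∀ a t, cornerOrbit (β a) (q a) t = cornerOrbit (β a) (c a) (i a + t) := fun a t =>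
    (cornerOrbit_add_eq (β a) (c a) (i a) t).symm
  have hdir' : ∀ a, (dist (Site.toComplex (cornerOrbit (β a) (q a) 0).1) z ≤ r ∧
        R ≤ dist (Site.toComplex (cornerOrbit (β a) (q a) (n a)).1) z) ∨
      (R ≤ dist (Site.toComplex (cornerOrbit (β a) (q a) 0).1) z ∧
        dist (Site.toComplex (cornerOrbit (β a) (q a) (n a)).1) z ≤ r) := by
    intro a
    rw [horb, horb, add_zero, show i a + n a = j a from Nat.add_sub_cancel' (hij a)]
    exact hdir a
  choose E F T m i' j' hEd hFd htight hTsub hmT hmstrict hi'm hmj' hj'n hchain hends using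
    fun a => strand_tightArc (β a) (q a) (n a) z hrR (hdir' a)
  set K : Set ℂ := ⋃ a, ⋃ jj ∈ Finset.range (2 * n a + 1),
    segment ℝ (pieceVert (β a) (q a) jj) (pieceVert (β a) (q a) (jj + 1)) with hK
  have hKc : IsClosed K := by
    refine isClosed_iUnion_of_finite fun a => isClosed_biUnion_finset fun jj _ => ?_
    rw [← Path.range_segment]
    exact (isCompact_range (Path.segment _ _).continuous).isClosed
  have hmemK : ∀ {w : ℂ}, w ∈ K ↔ ∃ a jj, jj ≤ 2 * n a ∧ w ∈ segment ℝ (pieceVert (β a) (q a) jj) (pieceVert (β a) (q a) (jj + 1)) := by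
    intro w
    simp only [hK, mem_iUnion, Finset.mem_range, exists_prop]
    constructor
    · rintro ⟨a, jj, hjj, hw⟩; exact ⟨a, jj, by omega, hw⟩
    · rintro ⟨a, jj, hjj, hw⟩; exact ⟨a, jj, by omega, hw⟩
  have hpieceK : ∀ a jj, jj ≤ 2 * n a → segment ℝ (pieceVert (β a) (q a) jj) (pieceVert (β a) (q a) (jj + 1)) ⊆ K :=
    fun a jj hjj w hw => hmemK.2 ⟨a, jj, hjj, hw⟩
  have hTK : ∀ a, range (T a) ⊆ K := by
    intro a w hw
    obtain ⟨jj, hjj, hw⟩ := mem_iUnion₂.1 (hTsub a hw)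
    exact hpieceK a jj (by have := Finset.mem_range.1 hjj; omega) hw
  have hvert : ∀ u : Site 2, Site.toComplex u ∉ K := fun u hu => by
    obtain ⟨a, jj, -, hw⟩ := hmemK.1 hu
    exact toComplex_not_mem_piece (β a) (q a) u jj hw
  have hcent : ∀ g : Site 2, faceCenter g ∉ K := fun g hg => by
    obtain ⟨a, jj, -, hw⟩ := hmemK.1 hg
    exact faceCenter_not_mem_piece (β a) (q a) g jj hw
  have hdisq : ∀ a b, a ≠ b → ∀ s u, s ≤ n a → u ≤ n b → cornerOrbit (β a) (q a) s ≠ cornerOrbit (β b) (q b) u := by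
    intro a b hab s u hs hu
    rw [horb, horb]
    have h1 := hij a; have h2 := hij b
    exact hdis a b hab (i a + s) (i b + u) (Nat.le_add_right _ _) (by simp only [hn] at hs; omega)
      (Nat.le_add_right _ _) (by simp only [hn] at hu; omega)
  have hKe : ∀ a u, u + 1 ≤ n a → cTgt (cornerOrbit (β a) (q a) u) ∈ β a →
      ∀ P ∈ segment ℝ (Site.toComplex (cornerOrbit (β a) (q a) u).1)
        (Site.toComplex ((cornerOrbit (β a) (q a) u).1 + cornerUnit ((cornerOrbit (β a) (q a) u).2 + 1))), P ∉ K := by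
    intro a u hu hopen P hP hPK
    obtain ⟨b, jj, hjj, hPb⟩ := hmemK.1 hPK
    by_cases hab : b = a
    · subst hab
      exact openEdge_not_mem_piece (q b) ((SimpleGraph.mem_edgeSet _).1 (cTgt_mem_edgeSet _)) hopen hPb hP
    · exact followedEdge_not_mem_pieces_HT4' (q a) (q b) hopen
        (fun s' u' hs' h2 => hdisq a b (Ne.symm hab) s' u' (by rcases hs' with rfl | rfl <;> omega) h2) hjj hPb hP
  have hKx : ∀ a u, u + 1 ≤ n a → cTgt (cornerOrbit (β a) (q a) u) ∉ β a →
      ∀ P ∈ segment ℝ (faceCenter (cFace (cornerOrbit (β a) (q a) u)))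
        (faceCenter (faceAt (cornerOrbit (β a) (q a) u).1 ((cornerOrbit (β a) (q a) u).2 + 1))), P ∉ K := by
    intro a u hu hclosed P hP hPK
    obtain ⟨b, jj, hjj, hPb⟩ := hmemK.1 hPK
    by_cases hab : b = a
    · subst hab
      exact crossSeg_not_mem_piece (q b) hclosed hPb hP
    · exact crossSeg_not_mem_pieces_HT4' (q a) (q b) hclosed
        (fun s' u' hs' h2 => hdisq a b (Ne.symm hab) s' u' (by rcases hs' with rfl | rfl <;> omega) h2) hjj hPb hP
  have hZK' : ∀ w ∈ Z, w ∉ K := by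
    intro w hwZ hwK
    obtain ⟨a, jj, hjj, hw⟩ := hmemK.1 hwK
    obtain ⟨t', rfl | rfl⟩ := Nat.even_or_odd' jj
    · rw [pieceVert_even, pieceVert_odd, horb] at hw
      have hia := hij a
      exact (hZK a (i a + t') (Nat.le_add_right _ _) (by simp only [hn] at hjj; omega)).1 w hw hwZ
    · rw [show 2 * t' + 1 + 1 = 2 * t' + 2 by ring, pieceVert_odd, pieceVert_odd_succ] at hw
      have h2 : sPt (nextCorner (β a) (cornerOrbit (β a) (q a) t')) = sPt (cornerOrbit (β a) (c a) (i a + t' + 1)) := by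
        rw [show i a + t' + 1 = i a + (t' + 1) by ring, ← horb]; rfl
      rw [h2, horb] at hw
      have hia := hij a
      exact (hZK a (i a + t') (Nat.le_add_right _ _) (by simp only [hn] at hjj; omega)).2
        (by simp only [hn] at hjj; omega) w hw hwZ
  have hdisj : ∀ a b, a ≠ b → Disjoint (range (T a)) (range (T b)) := by
    intro a b hab
    refine Set.disjoint_left.2 fun w hw hw' => ?_
    obtain ⟨jj, hjj, hw⟩ := mem_iUnion₂.1 (hTsub a hw)
    obtain ⟨jj', hjj', hw'⟩ := mem_iUnion₂.1 (hTsub b hw')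
    have hjj₁ := Finset.mem_range.1 hjj
    have hjj₂ := Finset.mem_range.1 hjj'
    obtain ⟨s, t, hs, ht, hst⟩ := pieces_meet_two_HT4 (q a) (q b) hw hw'
    exact hdisq a b hab s t (by omega) (by omega) hst
  set U : Set ℂ := {w | r + 1 / 2 < dist w z ∧ dist w z < R - 1 / 2} with hU
  set X : Set ℂ := U \ K with hX
  set cL : Fin k → Set ℂ := fun a => connectedComponentIn X (Site.toComplex (cornerOrbit (β a) (q a) (m a)).1) with hcL
  set cR : Fin k → Set ℂ := fun a => connectedComponentIn X (faceCenter (cFace (cornerOrbit (β a) (q a) (m a)))) with hcR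
  have hcc : ∀ a t, i' a ≤ t → t ≤ j' a →
      Site.toComplex (cornerOrbit (β a) (q a) t).1 ∈ cL a ∧ faceCenter (cFace (cornerOrbit (β a) (q a) t)) ∈ cR a :=
    fun a t h1 h2 => chain_in_component_steps_HT4 (β a) (q a) z K hvert hcent
      (fun u _ hu => hKe a u (by have := hj'n a; omega)) (fun u _ hu => hKx a u (by have := hj'n a; omega))
      (hchain a) (hi'm a) (hmj' a) h1 h2
  have hprobe : ∀ a, segment ℝ (Site.toComplex (cornerOrbit (β a) (q a) (m a)).1) (faceCenter (cFace (cornerOrbit (β a) (q a) (m a)))) ⊆ U ∧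
      (segment ℝ (Site.toComplex (cornerOrbit (β a) (q a) (m a)).1) (faceCenter (cFace (cornerOrbit (β a) (q a) (m a)))) ∩ K).Nonempty ∧
      segment ℝ (Site.toComplex (cornerOrbit (β a) (q a) (m a)).1) (faceCenter (cFace (cornerOrbit (β a) (q a) (m a)))) ∩ K ⊆
        segment ℝ (sPt (cornerOrbit (β a) (q a) (m a))) (tPt (cornerOrbit (β a) (q a) (m a))) := by
    intro a
    have hc := hchain a (m a) (hi'm a) (hmj' a)
    refine ⟨fun P hP => ?_, ?_, ?_⟩
    · obtain ⟨h1, h2⟩ := segment_annulus ⟨hc.1, hc.2.1⟩ ⟨hc.2.2.1, hc.2.2.2⟩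
        (by rw [dist_comm]; exact (dist_faceCenter_vertex_lt _).le.trans (by norm_num)) P hP
      exact ⟨by linarith, by linarith⟩
    · obtain ⟨P, hP, hPo⟩ := exists_mem_dartSeg_mem_openSegment (isCorner_cFace (cornerOrbit (β a) (q a) (m a)))
      refine ⟨P, openSegment_subset_segment ℝ _ _ hPo, hpieceK a (2 * m a) (by have := hmj' a; have := hj'n a; omega) ?_⟩
      rw [piece_even_eq_cyDart, cyDart_eq]; exact hP
    · rintro w ⟨hw, hwK⟩
      obtain ⟨b, jj, -, hwb⟩ := hmemK.1 hwK
      obtain ⟨s, rfl, hs⟩ := eq_of_mem_piece_halfDiag (β b) (q b) (v := (cornerOrbit (β a) (q a) (m a)).1)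
        (k := (cornerOrbit (β a) (q a) (m a)).2) hwb hw
      rw [pieceVert_even, pieceVert_odd, hs] at hwb
      exact hwb
  have htouch : ∀ a, (closure (cL a) ∩ range (T a) ∩ U).Nonempty ∧ (closure (cR a) ∩ range (T a) ∩ U).Nonempty := by
    intro a
    obtain ⟨hpU, hpne, hpD⟩ := hprobe a
    constructor
    · obtain ⟨P, hPD, hPcl⟩ := exists_mem_closure_of_probe hKc (hvert _) hpU hpne hpD
      exact ⟨P, ⟨hPcl, hmT a hPD⟩, hmstrict a P hPD⟩
    · rw [segment_symm] at hpU hpne hpD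
      obtain ⟨P, hPD, hPcl⟩ := exists_mem_closure_of_probe hKc (hcent _) hpU hpne hpD
      exact ⟨P, ⟨hPcl, hmT a hPD⟩, hmstrict a P hPD⟩
  have hthree : ∀ (S : Set ℂ), S ⊆ X → IsPreconnected S → ∀ a₁ a₂ a₃ : Fin k, a₁ ≠ a₂ → a₂ ≠ a₃ → a₃ ≠ a₁ →
      (closure S ∩ range (T a₁) ∩ U).Nonempty → (closure S ∩ range (T a₂) ∩ U).Nonempty →
      (closure S ∩ range (T a₃) ∩ U).Nonempty → False := by
    intro S hSX hS a₁ a₂ a₃ h12 h23 h31 ht1 ht2 ht3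
    exact not_three_arcs_touch (by linarith) (by linarith) T hEd hFd
      (fun l u => ⟨(htight l _ ⟨u, rfl⟩).1, (htight l _ ⟨u, rfl⟩).2.1⟩)
      (fun l u hu => (htight l _ ⟨u, rfl⟩).2.2.1 hu) (fun l u hu => (htight l _ ⟨u, rfl⟩).2.2.2 hu) hdisj hS
      (fun w hw => (hSX hw).1) (fun l => Set.disjoint_left.2 fun w hw hw' => (hSX hw).2 (hTK l hw')) h12 h23 h31
      ht1 ht2 ht3
  have hfibL : ∀ a₁ a₂ a₃ : Fin k, a₁ ≠ a₂ → a₂ ≠ a₃ → a₃ ≠ a₁ → cL a₁ = cL a₂ → cL a₂ = cL a₃ → False := by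
    intro a₁ a₂ a₃ h12 h23 h31 e12 e23
    refine hthree (cL a₁) (connectedComponentIn_subset _ _) isPreconnected_connectedComponentIn a₁ a₂ a₃ h12 h23 h31
      (htouch a₁).1 ?_ ?_
    · rw [e12]; exact (htouch a₂).1
    · rw [e12, e23]; exact (htouch a₃).1
  have hfibR : ∀ a₁ a₂ a₃ : Fin k, a₁ ≠ a₂ → a₂ ≠ a₃ → a₃ ≠ a₁ → cR a₁ = cR a₂ → cR a₂ = cR a₃ → False := by
    intro a₁ a₂ a₃ h12 h23 h31 e12 e23
    refine hthree (cR a₁) (connectedComponentIn_subset _ _) isPreconnected_connectedComponentIn a₁ a₂ a₃ h12 h23 h31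
      (htouch a₁).2 ?_ ?_
    · rw [e12]; exact (htouch a₂).2
    · rw [e12, e23]; exact (htouch a₃).2
  have hZX : Z ⊆ X := fun w hw => ⟨hZU w hw, hZK' w hw⟩
  have hZone : ∀ (C₁ C₂ : Set ℂ) (b₁ b₂ : ℂ), C₁ = connectedComponentIn X b₁ → C₂ = connectedComponentIn X b₂ →
      (C₁ ∩ Z).Nonempty → (C₂ ∩ Z).Nonempty → C₁ = C₂ := by
    rintro C₁ C₂ b₁ b₂ rfl rfl ⟨P₁, hP₁C, hP₁Z⟩ ⟨P₂, hP₂C, hP₂Z⟩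
    have hZsub : Z ⊆ connectedComponentIn X P₁ := hZc.subset_connectedComponentIn hP₁Z hZX
    rw [connectedComponentIn_eq hP₁C, connectedComponentIn_eq hP₂C]
    exact connectedComponentIn_eq (hZsub hP₂Z)
  have hXcomp : ∀ (b : ℂ) (S : Set ℂ), IsPreconnected S → S ⊆ U → (∀ w ∈ S, w ∉ K) →
      (S ∩ connectedComponentIn X b).Nonempty → S ⊆ connectedComponentIn X b := by
    rintro b S hS hSU hSK ⟨P, hPS, hPC⟩
    have h1 : S ⊆ connectedComponentIn X P := hS.subset_connectedComponentIn hPS fun w hw => ⟨hSU hw, hSK w hw⟩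
    rwa [← connectedComponentIn_eq hPC] at h1
  have hmemK' : ∀ {w : ℂ}, (∀ a jj, jj ≤ 2 * (j a - i a) →
      w ∉ segment ℝ (pieceVert (β a) (q a) jj) (pieceVert (β a) (q a) (jj + 1))) → w ∉ K := by
    intro w hw hwK
    obtain ⟨a, jj, hjj, hw'⟩ := hmemK.1 hwK
    exact hw a jj hjj hw'
  have key : ∀ s, i s ≤ i s + i' s ∧ i s + i' s ≤ i s + j' s ∧ i s + j' s ≤ j s ∧
      (∀ t, i s + i' s ≤ t → t ≤ i s + j' s →
        Site.toComplex (cornerOrbit (β s) (c s) t).1 ∈ cL s ∧ faceCenter (cFace (cornerOrbit (β s) (c s) t)) ∈ cR s ∧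
        r + 1 < dist (Site.toComplex (cornerOrbit (β s) (c s) t).1) z ∧ dist (Site.toComplex (cornerOrbit (β s) (c s) t).1) z < R - 1 ∧
        r + 1 < dist (faceCenter (cFace (cornerOrbit (β s) (c s) t))) z ∧ dist (faceCenter (cFace (cornerOrbit (β s) (c s) t))) z < R - 1) ∧
      ((dist (Site.toComplex (cornerOrbit (β s) (c s) (i s + i' s)).1) z < r + 3 ∧ dist (faceCenter (cFace (cornerOrbit (β s) (c s) (i s + i' s)))) z < r + 3 ∧
          R - 3 < dist (Site.toComplex (cornerOrbit (β s) (c s) (i s + j' s)).1) z ∧ R - 3 < dist (faceCenter (cFace (cornerOrbit (β s) (c s) (i s + j' s)))) z) ∨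
        (R - 3 < dist (Site.toComplex (cornerOrbit (β s) (c s) (i s + i' s)).1) z ∧ R - 3 < dist (faceCenter (cFace (cornerOrbit (β s) (c s) (i s + i' s)))) z ∧
          dist (Site.toComplex (cornerOrbit (β s) (c s) (i s + j' s)).1) z < r + 3 ∧ dist (faceCenter (cFace (cornerOrbit (β s) (c s) (i s + j' s)))) z < r + 3)) := by
    intro s
    have h3 := hj'n s; have h4 := hij s; have h5 := hi'm s; have h6 := hmj' s
    simp only [hn] at h3
    refine ⟨Nat.le_add_right _ _, by omega, by omega, fun t h1 h2 => ?_, ?_⟩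
    · have h1' : i' s ≤ t - i s := by omega
      have h2' : t - i s ≤ j' s := by omega
      have ht : cornerOrbit (β s) (c s) t = cornerOrbit (β s) (q s) (t - i s) := by
        rw [horb, show i s + (t - i s) = t by omega]
      have hc := hchain s (t - i s) h1' h2'
      have hcc' := hcc s (t - i s) h1' h2'
      rw [ht]
      exact ⟨hcc'.1, hcc'.2, hc.1, hc.2.1, hc.2.2.1, hc.2.2.2⟩
    · have e1 : cornerOrbit (β s) (c s) (i s + i' s) = cornerOrbit (β s) (q s) (i' s) := by rw [horb]
      have e2 : cornerOrbit (β s) (c s) (i s + j' s) = cornerOrbit (β s) (q s) (j' s) := by rw [horb]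
      rw [e1, e2]
      exact hends s
  refine ⟨cL, cR, fun s => i s + i' s, fun s => i s + j' s,
    fun s₁ s₂ P h1 h2 => (connectedComponentIn_eq h1).trans (connectedComponentIn_eq h2).symm,
    fun s₁ s₂ P h1 h2 => (connectedComponentIn_eq h1).trans (connectedComponentIn_eq h2).symm,
    hfibL, hfibR, fun s₁ s₂ h1 h2 => hZone _ _ _ _ rfl rfl h1 h2, fun s₁ s₂ h1 h2 => hZone _ _ _ _ rfl rfl h1 h2,
    fun s w hw => ?_, fun s => ⟨fun w hw => (connectedComponentIn_subset _ _ hw).1,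
      fun w hw => (connectedComponentIn_subset _ _ hw).1, isPreconnected_connectedComponentIn,
      isPreconnected_connectedComponentIn, fun w hw a jj hjj hw' => (connectedComponentIn_subset _ _ hw).2 (hpieceK a jj hjj hw'),
      fun w hw a jj hjj hw' => (connectedComponentIn_subset _ _ hw).2 (hpieceK a jj hjj hw'),
      fun S hS hSU hSK => ⟨hXcomp _ S hS hSU fun w hw => hmemK' (hSK w hw), hXcomp _ S hS hSU fun w hw => hmemK' (hSK w hw)⟩⟩,
    key⟩
  rcases hw with hw | hw
  · exact (connectedComponentIn_subset _ _ hw).1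
  · exact (connectedComponentIn_subset _ _ hw).1


/-- **Sectors with chains, several configurations** (registered anchor
`ufrs_strandsSectorsZ_chains` of stmt-CriticalPhenomena-11387; `strands_sectorsZ_chains_HT5` verbatim
with all binders explicit). -/
theorem ufrs_strandsSectorsZ_chains : ∀ (k : ℕ) (β : Fin k → BondConfig (Site 2)) (z : ℂ) (c : Fin k → Site 2 × Fin 4) (i j : Fin k → ℕ) (r R : ℝ), 0 ≤ r → r + 16 ≤ R → (∀ a, i a ≤ j a) → (∀ a, (dist (Site.toComplex (cornerOrbit (β a) (c a) (i a)).1) z ≤ r ∧ R ≤ dist (Site.toComplex (cornerOrbit (β a) (c a) (j a)).1) z) ∨ (R ≤ dist (Site.toComplex (cornerOrbit (β a) (c a) (i a)).1) z ∧ dist (Site.toComplex (cornerOrbit (β a) (c a) (j a)).1) z ≤ r)) → (∀ a b, a ≠ b → ∀ s t, i a ≤ s → s ≤ j a → i b ≤ t → t ≤ j b → cornerOrbit (β a) (c a) s ≠ cornerOrbit (β b) (c b) t) → ∀ (Z : Set ℂ), (∀ w ∈ Z, r + 1 / 2 < dist w z ∧ dist w z < R - 1 / 2) → IsPreconnected Z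 → (∀ a t, i a ≤ t → t ≤ j a → (∀ w ∈ segment ℝ (sPt (cornerOrbit (β a) (c a) t)) (tPt (cornerOrbit (β a) (c a) t)), w ∉ Z) ∧ (t < j a → ∀ w ∈ segment ℝ (tPt (cornerOrbit (β a) (c a) t)) (sPt (cornerOrbit (β a) (c a) (t + 1))), w ∉ Z)) → ∃ (cL cR : Fin k → Set ℂ) (i' j' : Fin k → ℕ), (∀ s₁ s₂ (P : ℂ), P ∈ cL s₁ → P ∈ cL s₂ → cL s₁ = cL s₂) ∧ (∀ s₁ s₂ (P : ℂ), P ∈ cR s₁ → P ∈ cR s₂ → cR s₁ = cR s₂) ∧ (∀ a₁ a₂ a₃ : Fin k, a₁ ≠ a₂ → a₂ ≠ a₃ → a₃ ≠ a₁ → cL a₁ = cL a₂ → cL a₂ = cL a₃ → False) ∧ (∀ a₁ a₂ a₃ : Fin k, a₁ ≠ a₂ → a₂ ≠ a₃ → a₃ ≠ a₁ → cR a₁ = cR a₂ → cR a₂ = cR a₃ → False) ∧ (∀ s₁ s₂, (cL s₁ ∩ Z).Nonempty → (cL s₂ ∩ Z).Nonempty → cL s₁ = cL s₂) ∧ (∀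 s₁ s₂, (cR s₁ ∩ Z).Nonempty → (cR s₂ ∩ Z).Nonempty → cR s₁ = cR s₂) ∧ (∀ s, ∀ w ∈ cL s ∪ cR s, r + 1 / 2 < dist w z ∧ dist w z < R - 1 / 2) ∧ (∀ s, cL s ⊆ {w | r + 1 / 2 < dist w z ∧ dist w z < R - 1 / 2} ∧ cR s ⊆ {w | r + 1 / 2 < dist w z ∧ dist w z < R - 1 / 2} ∧ IsPreconnected (cL s) ∧ IsPreconnected (cR s) ∧ (∀ w ∈ cL s, ∀ a jj, jj ≤ 2 * (j a - i a) → w ∉ segment ℝ (pieceVert (β a) (cornerOrbit (β a) (c a) (i a)) jj) (pieceVert (β a) (cornerOrbit (β a) (c a) (i a)) (jj + 1))) ∧ (∀ w ∈ cR s, ∀ a jj, jj ≤ 2 * (j a - i a) → w ∉ segment ℝ (pieceVert (β a) (cornerOrbit (β a) (c a) (i a)) jj) (pieceVert (β a) (cornerOrbit (β a) (c a) (i a)) (jj + 1))) ∧ (∀ S : Set ℂ, IsPreconnected S → S ⊆ {w | r + 1 / 2 < dist w z ∧ dist w z < R - 1 / 2} → (∀ w ∈ S, ∀ a jj, jj ≤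 2 * (j a - i a) → w ∉ segment ℝ (pieceVert (β a) (cornerOrbit (β a) (c a) (i a)) jj) (pieceVert (β a) (cornerOrbit (β a) (c a) (i a)) (jj + 1))) → ((S ∩ cL s).Nonempty → S ⊆ cL s) ∧ ((S ∩ cR s).Nonempty → S ⊆ cR s))) ∧ (∀ s, i s ≤ i' s ∧ i' s ≤ j' s ∧ j' s ≤ j s ∧ (∀ t, i' s ≤ t → t ≤ j' s → Site.toComplex (cornerOrbit (β s) (c s) t).1 ∈ cL s ∧ faceCenter (cFace (cornerOrbit (β s) (c s) t)) ∈ cR s ∧ r + 1 < dist (Site.toComplex (cornerOrbit (β s) (c s) t).1) z ∧ dist (Site.toComplex (cornerOrbit (β s) (c s) t).1) z < R - 1 ∧ r + 1 < dist (faceCenter (cFace (cornerOrbit (β s) (c s) t))) z ∧ dist (faceCenter (cFace (cornerOrbit (β s) (c s) t))) z < R - 1) ∧ ((dist (Site.toComplex (cornerOrbit (β s) (c s) (i' s)).1) z < r + 3 ∧ dist (faceCenter (cFace (cornerOrbit (β s) (c s) (i' s)))) z < r + 3 ∧ R - 3 < dist (Site.toComplex (cornerOrbit (β s) (c s) (j'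 s)).1) z ∧ R - 3 < dist (faceCenter (cFace (cornerOrbit (β s) (c s) (j' s)))) z) ∨ (R - 3 < dist (Site.toComplex (cornerOrbit (β s) (c s) (i' s)).1) z ∧ R - 3 < dist (faceCenter (cFace (cornerOrbit (β s) (c s) (i' s)))) z ∧ dist (Site.toComplex (cornerOrbit (β s) (c s) (j' s)).1) z < r + 3 ∧ dist (faceCenter (cFace (cornerOrbit (β s) (c s) (j' s)))) z < r + 3))) :=
  fun _k β z c i j _r _R hr hrR hij hdir hdis Z hZU hZc hZK => strands_sectorsZ_chains_HT5 β z c i j hr hrR hij hdir hdis Z hZU hZc hZK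

end

end Summit.CriticalPhenomena.CardyFormulaZ2.Cruxes.EdgePrecompact.QkzStripBoundaryArm
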